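import Mathlib
import HarnessLib
import Summits.NavierStokesRegularity.NavierStokesRegularity.Theses.TypeIIInviscidRelaxation
import Literature.Analysis.FluidPDE.TypeIICoreWitness

set_option linter.dupNamespace false

/-!
# Line `anchored_late_axisymmetric_core` for crux `MonopoleCoreExclusion` (stmt-NavierStokesRegularity-1965)

Route `TypeIIInviscidRelaxation`, crux (rank 4): GIVEN `AxisymSwirlRegular` (global regularity of axisymmetric
Navier–Stokes with swirl, the route's rank-2 crux, here a HYPOTHESIS), a non-Type-I blow-up whose
velocity-maximum core is, at every level `K` and frequently before `T`, `K⁻¹`-close on `K` core radii to an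
AXISYMMETRIC profile (`TypeIICoreWitness IsAxisymmetric ν K u t`) is impossible — the stability transfer
from exactly axisymmetric flows to nearly axisymmetric cores.

ARCHITECTURE (anchor + local finite horizon; two research stubs, kernel-checked composition) — the same
road as the sibling line `ColumnarCoreExclusion/Lines/anchored_late_columnar_core.lean`, with the
transfer hypothesis `AxisymSwirlRegular` entering the stability stub:

* `stub_anchoredLateAxisymWitness` [research · L] — ANCHORING/TIMING. From the crux hypotheses, some
  SINGULAR point `xs` of time `T` (no bound on any backward parabolic neighbourhood `(T-ρ², T) × B_ρ(xs)`)
  is covered, at every level `K`, by a LATE level-`K` axisymmetric witness `(t, x₀, L, V, Q, W)`: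
  `xs ∈ B̄(x₀, K L/4)` and `(T - t)·V ≤ K·L` (blow-up within `K` core turnovers).
* `stub_axisymCoreLocalHorizonOfAX` [research · XL; the TRANSFER] — assuming `AxisymSwirlRegular`, there
  is a universal level `K₀` such that a classical Leray–Hopf solution carrying at time `t` a level-`K ≥ K₀`
  axisymmetric witness centred at `x₀` with `(T - t)·V ≤ K·L` stays bounded on `[t, T) × B(x₀, K L/2)`:
  the exactly axisymmetric solution launched from (a localisation of) the profile is global by `AX`, and
  the stub is the finite-horizon, local, high-Reynolds STABILITY of that solution under `K⁻¹`-perturbations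
  at the core scale (print anchors for the mechanism: Ponce–Racke–Sideris–Titi 1994 stability of large
  global solutions; Gallay–Šverák 2019 / Bedrossian–Germain–Harrop-Griffiths 2018-23 uniqueness and
  stability of viscous vortex rings and filaments at high Reynolds number). Why it might fail:
  `C⁰`-closeness controls no sub-core-scale vorticity; stability constants of axisymmetric flows at
  Reynolds number `≥ K` may degenerate faster than `K⁻¹`.
* `MonopoleCoreExclusion_of` — PROVED composition: bound on `(T-ρ², T) × B_ρ(xs)`,
  `ρ = min (K₀ L/4) √(T-t)`, contradicting the singularity of `xs`.

No new definitions; stubs over `TypeIICoreWitness`, `IsAxisymmetric`, the route decl `AxisymSwirlRegular`,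
`IsMaximalSmoothSolution`, `IsLerayHopfOn`, `HasRapidSpatialDecay`, `IsTypeIBlowup`. Navier–Stokes
regularity is NOT proved by anything here. decomp-ns line-writer g0.
-/

namespace Summit.NavierStokesRegularity.NavierStokesRegularity.Cruxes.MonopoleCoreExclusion.AnchoredLateAxisymmetricCore

open Literature.Analysis.FluidPDE Set Metric

/-- [research · L] **Anchored late axisymmetric witnesses.** Under the solution hypotheses of the
crux `MonopoleCoreExclusion` (maximal smooth Leray–Hopf solution from rapidly decaying data, not
Type I, axisymmetric core witnesses at every level frequently before `T`), there is a point `xs`,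
SINGULAR at time `T` (unbounded on every backward parabolic neighbourhood), such that for every
level `K > 0` some level-`K` axisymmetric witness `(t, x₀, L, V, Q, W)`, `0 < t < T`, is LATE —
`(T - t)·V ≤ K·L` — and ANCHORED at `xs` — `dist xs x₀ ≤ K·L/4`. -/
theorem stub_anchoredLateAxisymWitness {ν T : ℝ}
    {u : ℝ → EuclideanSpace ℝ (Fin 3) → EuclideanSpace ℝ (Fin 3)}
    {p : ℝ → EuclideanSpace ℝ (Fin 3) → ℝ}
    (hν : 0 < ν) (hT : 0 < T) (hmax : IsMaximalSmoothSolution ν 0 u p T)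
    (hLH : IsLerayHopfOn T ν 0 (u 0) u) (hdec : HasRapidSpatialDecay (u 0))
    (hnI : ¬ IsTypeIBlowup u T)
    (hw : ∀ K : ℝ, 0 < K → ∀ t₀ < T, ∃ t, t₀ < t ∧ t < T ∧ TypeIICoreWitness IsAxisymmetric ν K u t) :
    ∃ xs : EuclideanSpace ℝ (Fin 3),
      (¬ ∃ ρ M : ℝ, 0 < ρ ∧ ∀ s ∈ Ioo (T - ρ ^ 2) T, ∀ x ∈ ball xs ρ, ‖u s x‖ ≤ M) ∧
      ∀ K : ℝ, 0 < K → ∃ t : ℝ, 0 < t ∧ t < T ∧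
        ∃ (x₀ : EuclideanSpace ℝ (Fin 3)) (L V : ℝ)
          (Q : EuclideanSpace ℝ (Fin 3) ≃ₗᵢ[ℝ] EuclideanSpace ℝ (Fin 3))
          (W : EuclideanSpace ℝ (Fin 3) → EuclideanSpace ℝ (Fin 3)),
          0 < L ∧ 0 < V ∧ IsAxisymmetric W ∧ (∀ x, ‖u t x‖ ≤ V) ∧
          (∃ x₁, dist x₁ x₀ ≤ L ∧ V ≤ 2 * ‖u t x₁‖) ∧
          (∃ y y' : EuclideanSpace ℝ (Fin 3), ‖y‖ ≤ 1 ∧ ‖y'‖ ≤ 1 ∧ (4 : ℝ)⁻¹ ≤ ‖W y - W y'‖) ∧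
          K * ν ≤ L * V ∧
          (∀ y : EuclideanSpace ℝ (Fin 3), ‖y‖ ≤ K →
            ‖V⁻¹ • Q.symm (u t (x₀ + L • Q y)) - W y‖ ≤ K⁻¹) ∧
          (T - t) * V ≤ K * L ∧ dist xs x₀ ≤ K * L / 4 := by
  sorry

/-- [research · XL; the TRANSFER from `AxisymSwirlRegular`; print anchors for the mechanism:
Ponce–Racke–Sideris–Titi 1994 (stability of large global solutions), Gallay–Šverák 2019 and
Bedrossian–Germain–Harrop-Griffiths (uniqueness / stability of viscous vortex rings and filaments)]
**Local finite-horizon regularity of near-axisymmetric cores, given `AX`.** If axisymmetric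
Navier–Stokes with swirl is globally regular (`AxisymSwirlRegular`), there is a universal level
`K₀ > 0` such that: if a classical solution on `[0, T)`, Leray–Hopf from rapidly decaying data,
carries at a time `0 < t < T` a level-`K` axisymmetric core witness (`K ≥ K₀`: sup `V`,
near-maximum within `L` of `x₀`, core Reynolds number `L V/ν ≥ K`, `K⁻¹`-close on `K` core radii,
after rescaling and a rigid motion `Q`, to a non-constant axisymmetric profile `W`) and `T` lies
within `K` core turnovers, `(T - t)·V ≤ K·L`, then `u` is bounded on `[t, T) × B(x₀, K L/2)`. -/
theorem stub_axisymCoreLocalHorizonOfAX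
    (hAX : Summit.NavierStokesRegularity.NavierStokesRegularity.Theses.TypeIIInviscidRelaxation.AxisymSwirlRegular) :
    ∃ K₀ : ℝ, 0 < K₀ ∧ ∀ K : ℝ, K₀ ≤ K →
      ∀ (ν T t : ℝ) (u : ℝ → EuclideanSpace ℝ (Fin 3) → EuclideanSpace ℝ (Fin 3))
        (p : ℝ → EuclideanSpace ℝ (Fin 3) → ℝ),
        0 < ν → 0 < T → IsClassicalNSSolutionOn (Ico 0 T) ν 0 u p → IsLerayHopfOn T ν 0 (u 0) u →
        HasRapidSpatialDecay (u 0) → 0 < t → t < T →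
        ∀ (x₀ : EuclideanSpace ℝ (Fin 3)) (L V : ℝ)
          (Q : EuclideanSpace ℝ (Fin 3) ≃ₗᵢ[ℝ] EuclideanSpace ℝ (Fin 3))
          (W : EuclideanSpace ℝ (Fin 3) → EuclideanSpace ℝ (Fin 3)),
          0 < L → 0 < V → IsAxisymmetric W → (∀ x, ‖u t x‖ ≤ V) →
          (∃ x₁, dist x₁ x₀ ≤ L ∧ V ≤ 2 * ‖u t x₁‖) →
          (∃ y y' : EuclideanSpace ℝ (Fin 3), ‖y‖ ≤ 1 ∧ ‖y'‖ ≤ 1 ∧ (4 : ℝ)⁻¹ ≤ ‖W y - W y'‖) →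
          K * ν ≤ L * V →
          (∀ y : EuclideanSpace ℝ (Fin 3), ‖y‖ ≤ K →
            ‖V⁻¹ • Q.symm (u t (x₀ + L • Q y)) - W y‖ ≤ K⁻¹) →
          (T - t) * V ≤ K * L →
          ∃ M : ℝ, ∀ s ∈ Ico t T, ∀ x ∈ ball x₀ (K * L / 2), ‖u s x‖ ≤ M := by
  sorry

/-- **Composition (kernel-checked, no sorry outside the stubs):** the two stubs imply the crux
`MonopoleCoreExclusion` BY NAME. The hypothesis `AX` feeds the stability stub; the late level-`K₀`
axisymmetric witness anchored at the singular point `xs` and the local horizon bound on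
`[t, T) × B(x₀, K₀L/2)` bound `u` on the backward parabolic neighbourhood `(T - ρ², T) × B_ρ(xs)`,
`ρ = min (K₀L/4) √(T - t)` — contradicting the singularity of `xs`. -/
theorem MonopoleCoreExclusion_of :
    Summit.NavierStokesRegularity.NavierStokesRegularity.Theses.TypeIIInviscidRelaxation.MonopoleCoreExclusion := by
  intro hAX ν T hν hT u p hmax hLH hdec hnI hw
  obtain ⟨K₀, hK₀, hstab⟩ := stub_axisymCoreLocalHorizonOfAX hAX
  obtain ⟨xs, hsing, hcov⟩ := stub_anchoredLateAxisymWitness hν hT hmax hLH hdec hnI hw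
  obtain ⟨t, ht0, htT, x₀, L, V, Q, W, hL, hV, hax, hbd, hnear, hosc, hRe, hclose, hlate, hdist⟩ :=
    hcov K₀ hK₀
  obtain ⟨M, hM⟩ := hstab K₀ le_rfl ν T t u p hν hT hmax.1 hLH hdec ht0 htT x₀ L V Q W hL hV hax
    hbd hnear hosc hRe hclose hlate
  apply hsing
  have hTt : 0 < T - t := sub_pos.2 htT
  set ρ : ℝ := min (K₀ * L / 4) (Real.sqrt (T - t)) with hρ
  have hρpos : 0 < ρ := lt_min (by positivity) (Real.sqrt_pos.2 hTt)
  have hρsq : ρ ^ 2 ≤ T - t :=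
    calc ρ ^ 2 ≤ (Real.sqrt (T - t)) ^ 2 := pow_le_pow_left₀ hρpos.le (min_le_right _ _) 2
      _ = T - t := Real.sq_sqrt hTt.le
  have hρle : ρ ≤ K₀ * L / 4 := min_le_left _ _
  refine ⟨ρ, M, hρpos, fun s hs x hx => hM s ⟨?_, hs.2⟩ x ?_⟩
  · linarith [hs.1]
  · rw [mem_ball] at hx ⊢
    calc dist x x₀ ≤ dist x xs + dist xs x₀ := dist_triangle _ _ _
      _ < ρ + K₀ * L / 4 := by linarith
      _ ≤ K₀ * L / 4 + K₀ * L / 4 := by linarith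
      _ = K₀ * L / 2 := by ring

end Summit.NavierStokesRegularity.NavierStokesRegularity.Cruxes.MonopoleCoreExclusion.AnchoredLateAxisymmetricCore
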